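import Literature.NumberTheory.EllipticCurves.WeierstrassAutFixedPointsProofs
import Literature.NumberTheory.EllipticCurves.GoodReductionInertia
import Literature.NumberTheory.EllipticCurves.GeomPointReduction
import Literature.NumberTheory.EllipticCurves.TorsionCardinality
import HarnessLib

/-!
# Inertia acts on the reduction of a potentially good curve through Weierstrass automorphisms:
# triviality on the `ℓ`-power torsion for one `ℓ` forces triviality on all prime-to-`p` torsion

`Proofs` file (theorems only, no definitions, no named facts, no instances) in topic
`NumberTheory/EllipticCurves`, landed by the tenured seat of bsd.S15
(`Literature.NumberTheory.EllipticCurves.conductorNorm_eq_artinConductorNat`) as the local core of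
the `ℓ`-independence statement Silverman *ATAEC* Thm. IV.10.2(c) ("`f(E/K)` is independent of
`ℓ`"; cited out in the book, PDF p. 362, to Serre–Tate 1968 §3) at the places of potential good
reduction.

## Setting and idea

`(L, w)` is a valued field (`w : Valuation L ℝ≥0`; in the application `L = K̄_v` with its
spectral valuation), `F ⊆ L` a subfield, `X` a Weierstrass equation over `F`, and `C` a change of
variables **over `L`** such that `W' = C • X_L` is `w`-integral with unit discriminant (a good
model, e.g. the Legendre form when `ord(j) ≥ 0`).  Let `σ ∈ Aut(L/F)` be an isometry acting
trivially on the residue field of `𝒪_w` (an inertia element).  Then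

* `A_σ = C (σC)⁻¹` satisfies `A_σ • σ(W') = W'`; both `W'` and `σ(W')` being integral with unit
  discriminant, `A_σ` is `w`-integral with unit `u` (*AEC* VII.1.3(d) in valuation form,
  `val_le_one_of_smul_eq_of_val_Δ_eq_one`), so it reduces to a change of variables `Ã_σ` over the
  residue field with `Ã_σ • W̃' = W̃'` — **an automorphism of the reduced curve**;
* for every point `P ∈ X(L)`: `red(Φ(σP)) = Ã_σ(red(Φ P))`, where `Φ : X(L) ≃ W'(L)` is the
  substitution and `red : W'(L) → W̃'(k)` the good-reduction homomorphism
  (`red_smul_eq_reducedAut_red`): inertia acts on the reduction through `Ã_σ`;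
* if `σ` fixes the `ℓ`-power torsion of `X(L)` for one prime `ℓ` with `w(ℓ) = 1` (and `L` is
  algebraically closed of characteristic `0`, `X` elliptic), then `Ã_σ` fixes the reductions of
  these infinitely many points, which are distinct (`E[ℓⁿ] ↪ Ẽ`, *AEC* VII.3.1(b)), so `Ã_σ = 1`
  (`VariableChange.eq_one_of_infinite_fixedPoints`), whence `red(Φ(σP)) = red(Φ P)` for all `P`
  and **`σ` fixes every `m`-torsion point with `w(m) = 1`**
  (`smul_eq_of_forall_smul_torsion_eq`).

This is the mechanism of Serre–Tate, *Good reduction of abelian varieties*, §2 (Thm. 2: the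
character of the inertia action on `T_ℓ` is independent of `ℓ`) specialised to the question of
*triviality*, which is all the Swan conductor of a `2`-dimensional representation of determinant
`1` sees; no Néron models are needed, only Weierstrass coordinates.

## References

* [SilvermanATAEC1994] J. H. Silverman, *Advanced Topics*, Thm. IV.10.2(c) and the remark on its
  proof (PDF p. 362: "Ogg [2], Serre [7, chapter 19], and Serre–Tate [1, §3]").
* [SerreTate1968] J.-P. Serre, J. Tate, *Good reduction of abelian varieties*, Ann. of Math. 88
  (1968), §2 Thm. 2, §3.
* [SilvermanAEC2009] J. H. Silverman, *The Arithmetic of Elliptic Curves*, 2nd ed., VII.1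
  Prop. 1.3(d), VII.2 Prop. 2.1, VII.3 Prop. 3.1(b).

## Design

Pure theorems, valued-field level (as `GoodReductionInertia`), `namespace
Literature.NumberTheory.EllipticCurves`; the reduced change of variables and the maps `Φ`, `red`
are built inside the proofs from the tree's `pointEquiv`, `congrEquiv`, `goodReductionHom`.
Axioms: `propext`, `Classical.choice`, `Quot.sound`.
-/

noncomputable section

open scoped Classical NNReal
open WeierstrassCurve

universe u

namespace Literature.NumberTheory.EllipticCurves

/-! ## §1. Coordinate identities for products and images of changes of variables -/

section Coordinates

variable {R : Type*} [Field R]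

/-- `(C C').toX = C.toX ∘ C'.toX` (the product of changes of variables acts by first `C'`, then
`C`, as `(C C') • W = C • (C' • W)`). [folklore] -/
theorem toX_mul (C C' : VariableChange R) (x : R) : (C * C').toX x = C.toX (C'.toX x) := by
  simp only [VariableChange.toX_def, VariableChange.mul_def, Units.val_inv_eq_inv_val,
    Units.val_mul]
  field_simp
  ring

/-- `(C C').toY = C.toY ∘ (C'.toX, C'.toY)`. [folklore] -/
theorem toY_mul (C C' : VariableChange R) (x y : R) :
    (C * C').toY x y = C.toY (C'.toX x) (C'.toY x y) := by
  simp only [VariableChange.toX_def, VariableChange.toY_def, VariableChange.mul_def,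
    Units.val_inv_eq_inv_val, Units.val_mul]
  field_simp
  ring

/-- `toX` of the identity change of variables is the identity. [folklore] -/
theorem toX_one (x : R) : (1 : VariableChange R).toX x = x := by
  simp [VariableChange.toX_def, VariableChange.one_def]

/-- `toY` of the identity change of variables is the identity. [folklore] -/
theorem toY_one (x y : R) : (1 : VariableChange R).toY x y = y := by
  simp [VariableChange.toY_def, VariableChange.one_def]

end Coordinates

section MapCoordinates

variable {R : Type*} [CommRing R] {S : Type*} [CommRing S]

/-- A ring homomorphism carries `C.toX x` to `(C.map f).toX (f x)`. [folklore] -/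
theorem map_toX_ringHom (C : VariableChange R) (f : R →+* S) (x : R) :
    f (C.toX x) = (C.map f).toX (f x) := by
  simp only [VariableChange.toX_def, VariableChange.map, Units.coe_map_inv, MonoidHom.coe_coe,
    map_mul, map_pow, map_sub]

/-- A ring homomorphism carries `C.toY x y` to `(C.map f).toY (f x) (f y)`. [folklore] -/
theorem map_toY_ringHom (C : VariableChange R) (f : R →+* S) (x y : R) :
    f (C.toY x y) = (C.map f).toY (f x) (f y) := by
  simp only [VariableChange.toY_def, VariableChange.map, Units.coe_map_inv, MonoidHom.coe_coe,
    map_mul, map_pow, map_sub]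

end MapCoordinates

/-! ## §2. A change of variables between two good integral models is integral (valuation form of
Silverman *AEC* VII.1.3(d)) -/

section Integrality

variable {L : Type u} [Field L] {w : Valuation L ℝ≥0}

/-- **Silverman *AEC* VII.1.3(d), valuation form over any valued field.**  If `V` and `A • V` are
both `w`-integral with unit discriminant then `w(u) = 1` and `w(r), w(s), w(t) ≤ 1` for
`A = (u, r, s, t)`.  Proof: `Δ' = u⁻¹²Δ` gives `w(u) = 1`; from the transformation formulae
`u⁶b₆' = b₆ + 2rb₄ + r²b₂ + 4r³` and `u⁸b₈' = b₈ + 3rb₆ + 3r²b₄ + r³b₂ + 3r⁴` (III.1 Table 3.1),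
`w(r) > 1` would force `w(4) < 1` and `w(3) < 1`, i.e. `w(1) < 1`; then `s² + a₁s` and
`t² + (a₃ + ra₁)t` are integral, so `w(s), w(t) ≤ 1`.
[cite: SilvermanAEC2009, VII.1 Prop. 1.3(d) with III.1 Table 3.1] -/
theorem val_le_one_of_smul_eq_of_val_Δ_eq_one (V : WeierstrassCurve L) [hV : V.IsIntegral w.integer]
    (A : VariableChange L) [hV' : (A • V).IsIntegral w.integer]
    (hΔ : w V.Δ = 1) (hΔ' : w (A • V).Δ = 1) :
    w (A.u : L) = 1 ∧ w A.r ≤ 1 ∧ w A.s ≤ 1 ∧ w A.t ≤ 1 := by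
  have hv0 : w.Integers w.integer := Valuation.integer.integers w
  obtain ⟨X, hX⟩ := hV.integral
  obtain ⟨Y, hY⟩ := hV'.integral
  have hle : ∀ a : w.integer, w (algebraMap w.integer L a) ≤ 1 := fun a ↦ hv0.map_le_one a
  have hnat : ∀ n : ℕ, w (n : L) ≤ 1 := fun n ↦ by
    rw [← map_natCast (algebraMap w.integer L) n]; exact hle _
  have hu0 : (A.u : L) ≠ 0 := A.u.ne_zero
  -- `w u = 1`
  have hu : w (A.u : L) = 1 := by
    have h := congrArg w (variableChange_Δ V A)
    rw [hΔ', map_mul, hΔ, mul_one, map_pow, Units.val_inv_eq_inv_val, map_inv₀] at h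
    have h' : (w (A.u : L))⁻¹ = 1 := (pow_eq_one_iff_of_nonneg zero_le (by norm_num)).mp h.symm
    exact inv_eq_one.mp h'
  have wu : ∀ n : ℕ, w ((A.u : L) ^ n) = 1 := fun n ↦ by rw [map_pow, hu, one_pow]
  -- the transformation formulae, denominators cleared
  have h6 : (A.u : L) ^ 6 * (A • V).b₆ = V.b₆ + 2 * A.r * V.b₄ + A.r ^ 2 * V.b₂ + 4 * A.r ^ 3 := by
    rw [variableChange_b₆, Units.val_inv_eq_inv_val, ← mul_assoc, ← mul_pow, mul_inv_cancel₀ hu0,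
      one_pow, one_mul]
  have h8 : (A.u : L) ^ 8 * (A • V).b₈ =
      V.b₈ + 3 * A.r * V.b₆ + 3 * A.r ^ 2 * V.b₄ + A.r ^ 3 * V.b₂ + 3 * A.r ^ 4 := by
    rw [variableChange_b₈, Units.val_inv_eq_inv_val, ← mul_assoc, ← mul_pow, mul_inv_cancel₀ hu0,
      one_pow, one_mul]
  have h2 : (A.u : L) ^ 2 * (A • V).a₂ = V.a₂ - A.s * V.a₁ + 3 * A.r - A.s ^ 2 := by
    rw [variableChange_a₂, Units.val_inv_eq_inv_val, ← mul_assoc, ← mul_pow, mul_inv_cancel₀ hu0,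
      one_pow, one_mul]
  have h6' : (A.u : L) ^ 6 * (A • V).a₆ =
      V.a₆ + A.r * V.a₄ + A.r ^ 2 * V.a₂ + A.r ^ 3 - A.t * V.a₃ - A.t ^ 2 - A.r * A.t * V.a₁ := by
    rw [variableChange_a₆, Units.val_inv_eq_inv_val, ← mul_assoc, ← mul_pow, mul_inv_cancel₀ hu0,
      one_pow, one_mul]
  -- valuations of the coefficients of the two integral models
  have wb : ∀ (Z : WeierstrassCurve w.integer),
      w (Z.baseChange L).b₂ ≤ 1 ∧ w (Z.baseChange L).b₄ ≤ 1 ∧ w (Z.baseChange L).b₆ ≤ 1 ∧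
      w (Z.baseChange L).b₈ ≤ 1 ∧ w (Z.baseChange L).a₁ ≤ 1 ∧ w (Z.baseChange L).a₂ ≤ 1 ∧
      w (Z.baseChange L).a₃ ≤ 1 ∧ w (Z.baseChange L).a₄ ≤ 1 ∧ w (Z.baseChange L).a₆ ≤ 1 := by
    intro Z
    simp only [WeierstrassCurve.baseChange, map_b₂, map_b₄, map_b₆, map_b₈, map_a₁, map_a₂,
      map_a₃, map_a₄, map_a₆]
    exact ⟨hle _, hle _, hle _, hle _, hle _, hle _, hle _, hle _, hle _⟩
  obtain ⟨hb₂, hb₄, hb₆, hb₈, ha₁, ha₂, ha₃, ha₄, ha₆⟩ := wb X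
  obtain ⟨-, -, hb₆', hb₈', -, ha₂', -, -, ha₆'⟩ := wb Y
  rw [← hX] at hb₂ hb₄ hb₆ hb₈ ha₁ ha₂ ha₃ ha₄ ha₆
  rw [← hY] at hb₆' hb₈' ha₂' ha₆'
  -- `w r ≤ 1`: otherwise `w 4 < 1` and `w 3 < 1`
  have hr : w A.r ≤ 1 := by
    by_contra hr
    rw [not_le] at hr
    set ρ := w A.r with hρ
    have hρ1 : 1 ≤ ρ := hr.le
    have hρpow : ∀ {m n : ℕ}, m ≤ n → ρ ^ m ≤ ρ ^ n := fun h ↦ pow_le_pow_right₀ hρ1 h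
    have hρ1pow : ∀ n : ℕ, (1 : ℝ≥0) ≤ ρ ^ n := fun n ↦ one_le_pow₀ hρ1
    have wr : ∀ n : ℕ, w (A.r ^ n) = ρ ^ n := fun n ↦ by rw [map_pow]
    -- `w 4 · ρ³ ≤ ρ²`
    have e4 : (4 : L) * A.r ^ 3 =
        (A.u : L) ^ 6 * (A • V).b₆ - V.b₆ - 2 * A.r * V.b₄ - A.r ^ 2 * V.b₂ := by
      linear_combination -h6
    have i4 : w (4 : L) * ρ ^ 3 ≤ ρ ^ 2 := by
      have : w ((4 : L) * A.r ^ 3) ≤ ρ ^ 2 := by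
        rw [e4]
        refine Valuation.map_sub_le _ (Valuation.map_sub_le _ (Valuation.map_sub_le _ ?_ ?_) ?_) ?_
        · rw [map_mul, wu, one_mul]; exact le_trans hb₆' (hρ1pow 2)
        · exact le_trans hb₆ (hρ1pow 2)
        · rw [map_mul, map_mul]
          calc w 2 * w A.r * w V.b₄ ≤ 1 * ρ * 1 :=
                mul_le_mul' (mul_le_mul' (hnat 2) le_rfl) hb₄
            _ = ρ ^ 1 := by ring
            _ ≤ ρ ^ 2 := hρpow (by norm_num)
        · rw [map_mul, wr]
          calc ρ ^ 2 * w V.b₂ ≤ ρ ^ 2 * 1 := mul_le_mul' le_rfl hb₂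
            _ = ρ ^ 2 := mul_one _
      rwa [map_mul, wr] at this
    -- `w 3 · ρ⁴ ≤ ρ³`
    have e3 : (3 : L) * A.r ^ 4 = (A.u : L) ^ 8 * (A • V).b₈ - V.b₈ - 3 * A.r * V.b₆ -
        3 * A.r ^ 2 * V.b₄ - A.r ^ 3 * V.b₂ := by
      linear_combination -h8
    have i3 : w (3 : L) * ρ ^ 4 ≤ ρ ^ 3 := by
      have : w ((3 : L) * A.r ^ 4) ≤ ρ ^ 3 := by
        rw [e3]
        refine Valuation.map_sub_le _ (Valuation.map_sub_le _ (Valuation.map_sub_le _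
          (Valuation.map_sub_le _ ?_ ?_) ?_) ?_) ?_
        · rw [map_mul, wu, one_mul]; exact le_trans hb₈' (hρ1pow 3)
        · exact le_trans hb₈ (hρ1pow 3)
        · rw [map_mul, map_mul]
          calc w 3 * w A.r * w V.b₆ ≤ 1 * ρ * 1 :=
                mul_le_mul' (mul_le_mul' (hnat 3) le_rfl) hb₆
            _ = ρ ^ 1 := by ring
            _ ≤ ρ ^ 3 := hρpow (by norm_num)
        · rw [map_mul, map_mul, wr]
          calc w 3 * ρ ^ 2 * w V.b₄ ≤ 1 * ρ ^ 2 * 1 :=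
                mul_le_mul' (mul_le_mul' (hnat 3) le_rfl) hb₄
            _ = ρ ^ 2 := by ring
            _ ≤ ρ ^ 3 := hρpow (by norm_num)
        · rw [map_mul, wr]
          calc ρ ^ 3 * w V.b₂ ≤ ρ ^ 3 * 1 := mul_le_mul' le_rfl hb₂
            _ = ρ ^ 3 := mul_one _
      rwa [map_mul, wr] at this
    have hρpos : ∀ n : ℕ, 0 < ρ ^ n := fun n ↦ pow_pos (lt_of_lt_of_le zero_lt_one hρ1) n
    have lt4 : w (4 : L) < 1 := by
      have : w (4 : L) * ρ ^ 3 < 1 * ρ ^ 3 := by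
        calc w (4 : L) * ρ ^ 3 ≤ ρ ^ 2 := i4
          _ < ρ ^ 3 := pow_lt_pow_right₀ hr (by norm_num)
          _ = 1 * ρ ^ 3 := (one_mul _).symm
      exact lt_of_mul_lt_mul_right' this
    have lt3 : w (3 : L) < 1 := by
      have : w (3 : L) * ρ ^ 4 < 1 * ρ ^ 4 := by
        calc w (3 : L) * ρ ^ 4 ≤ ρ ^ 3 := i3
          _ < ρ ^ 4 := pow_lt_pow_right₀ hr (by norm_num)
          _ = 1 * ρ ^ 4 := (one_mul _).symm
      exact lt_of_mul_lt_mul_right' this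
    have : w ((4 : L) - 3) < 1 := lt_of_le_of_lt (Valuation.map_sub _ _ _) (max_lt lt4 lt3)
    rw [show (4 : L) - 3 = 1 by norm_num, map_one] at this
    exact lt_irrefl _ this
  -- `w s ≤ 1`: `s² + a₁ s` is integral
  have hs : w A.s ≤ 1 := by
    by_contra hs
    rw [not_le] at hs
    set τ := w A.s with hτ
    have es : A.s ^ 2 = V.a₂ - A.s * V.a₁ + 3 * A.r - (A.u : L) ^ 2 * (A • V).a₂ := by
      linear_combination h2
    have : τ ^ 2 ≤ τ := by
      have h : w (A.s ^ 2) ≤ τ := by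
        rw [es]
        refine Valuation.map_sub_le _ (Valuation.map_add_le _ (Valuation.map_sub_le _ ?_ ?_) ?_) ?_
        · exact le_trans ha₂ hs.le
        · rw [map_mul]
          calc τ * w V.a₁ ≤ τ * 1 := mul_le_mul' le_rfl ha₁
            _ = τ := mul_one _
        · rw [map_mul]
          calc w 3 * w A.r ≤ 1 * 1 := mul_le_mul' (hnat 3) hr
            _ = 1 := mul_one _
            _ ≤ τ := hs.le
        · rw [map_mul, wu, one_mul]; exact le_trans ha₂' hs.le
      rwa [map_pow] at h
    have h1 : τ ≤ 1 := by
      have hτpos : 0 < τ := lt_trans zero_lt_one hs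
      calc τ = τ ^ 2 * τ⁻¹ := by rw [sq, mul_assoc, mul_inv_cancel₀ hτpos.ne', mul_one]
        _ ≤ τ * τ⁻¹ := mul_le_mul' this le_rfl
        _ = 1 := mul_inv_cancel₀ hτpos.ne'
    exact absurd h1 (not_le.mpr hs)
  -- `w t ≤ 1`: `t² + (a₃ + r a₁) t` is integral
  have ht : w A.t ≤ 1 := by
    by_contra ht
    rw [not_le] at ht
    set τ := w A.t with hτ
    have et : A.t ^ 2 = V.a₆ + A.r * V.a₄ + A.r ^ 2 * V.a₂ + A.r ^ 3 - A.t * V.a₃ -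
        A.r * A.t * V.a₁ - (A.u : L) ^ 6 * (A • V).a₆ := by
      linear_combination h6'
    have wr : ∀ n : ℕ, w (A.r ^ n) ≤ 1 := fun n ↦ by rw [map_pow]; exact pow_le_one₀ zero_le hr
    have : τ ^ 2 ≤ τ := by
      have h : w (A.t ^ 2) ≤ τ := by
        rw [et]
        refine Valuation.map_sub_le _ (Valuation.map_sub_le _ (Valuation.map_sub_le _
          (Valuation.map_add_le _ (Valuation.map_add_le _ (Valuation.map_add_le _ ?_ ?_) ?_) ?_)
          ?_) ?_) ?_
        · exact le_trans ha₆ ht.le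
        · rw [map_mul]
          exact le_trans (le_trans (mul_le_mul' hr ha₄) (by rw [one_mul])) ht.le
        · rw [map_mul]
          exact le_trans (le_trans (mul_le_mul' (wr 2) ha₂) (by rw [one_mul])) ht.le
        · exact le_trans (wr 3) ht.le
        · rw [map_mul]
          calc τ * w V.a₃ ≤ τ * 1 := mul_le_mul' le_rfl ha₃
            _ = τ := mul_one _
        · rw [map_mul, map_mul]
          calc w A.r * τ * w V.a₁ ≤ 1 * τ * 1 := mul_le_mul' (mul_le_mul' hr le_rfl) ha₁
            _ = τ := by ring
        · rw [map_mul, wu, one_mul]; exact le_trans ha₆' ht.le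
      rwa [map_pow] at h
    have h1 : τ ≤ 1 := by
      have hτpos : 0 < τ := lt_trans zero_lt_one ht
      calc τ = τ ^ 2 * τ⁻¹ := by rw [sq, mul_assoc, mul_inv_cancel₀ hτpos.ne', mul_one]
        _ ≤ τ * τ⁻¹ := mul_le_mul' this le_rfl
        _ = 1 := mul_inv_cancel₀ hτpos.ne'
    exact absurd h1 (not_le.mpr ht)
  exact ⟨hu, hr, hs, ht⟩

end Integrality

/-! ## §3. Inertia acts on the reduction through a change of variables over the residue field -/

section Core

variable {L : Type u} [Field L] {w : Valuation L ℝ≥0}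
  {F : Type*} [Field F] [Algebra F L]

/-- **Inertia acts on the reduction of a good model through an automorphism of the reduced
curve.**  Let `W' = C • X_L = W₀ ⊗ L` be a `w`-integral model with unit discriminant of the base
change to `L` of a Weierstrass equation `X` over the subfield `F`, the change of variables `C`
being defined over `L`; let `σ ∈ Aut(L/F)` be an isometry acting trivially on the residue field
of `𝒪_w`.  Then there is a change of variables `Ã` over the residue field `k` with `Ã • W̃₀ = W̃₀`
such that for every `P ∈ X(L)`, writing `Φ : X(L) ≃ W₀(L)` for the substitution and
`red : W₀(L) → W̃₀(k)` for the reduction homomorphism,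
`red(Φ(P^σ)) = Ã(red(Φ(P)))`.  Here `Ã` is the reduction of `A_σ = C(σC)⁻¹`, which satisfies
`A_σ • σ(W') = W'` and is `w`-integral with unit `u` (`val_le_one_of_smul_eq_of_val_Δ_eq_one`).
(Serre–Tate 1968 §2, in Weierstrass coordinates; Silverman *AEC* VII.1.3(d), VII.2.1.)
[cite: SerreTate1968, §2 Thm. 2 (mechanism of proof)]
[cite: SilvermanAEC2009, VII.1 Prop. 1.3(d) and VII.2 Prop. 2.1] -/
theorem exists_reducedAut_red_map_eq (X : WeierstrassCurve F) (C : VariableChange L)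
    {W₀ : WeierstrassCurve w.integer} (hW₀ : C • X.baseChange L = W₀.baseChange L)
    (hΔ : IsUnit W₀.Δ) (σ : L ≃ₐ[F] L) (hσ : ∀ z, w (σ z) = w z)
    (hσI : ∀ z, w z ≤ 1 → w (σ z - z) < 1) :
    ∃ (Ã : VariableChange (IsLocalRing.ResidueField w.integer))
      (hÃ : Ã • W₀.map (IsLocalRing.residue w.integer) = W₀.map (IsLocalRing.residue w.integer)),
      ∀ P : (X.baseChange L).toAffine.Point,
        goodReductionHom W₀ (Valuation.integer.integers w) hΔ
            (Affine.Point.congrEquiv hW₀ (VariableChange.pointEquiv (X.baseChange L) C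
              (Affine.Point.map (σ : L →ₐ[F] L) P))) =
          Affine.Point.congrEquiv hÃ (VariableChange.pointEquiv _ Ã
            (goodReductionHom W₀ (Valuation.integer.integers w) hΔ
              (Affine.Point.congrEquiv hW₀ (VariableChange.pointEquiv (X.baseChange L) C P)))) := by
  have hv0 : w.Integers w.integer := Valuation.integer.integers w
  have hinj : Function.Injective (algebraMap w.integer L) := hv0.hom_inj
  haveI hell : (W₀.map (IsLocalRing.residue w.integer)).IsElliptic := isElliptic_map_residue hΔ
  let O := w.integer
  let k := IsLocalRing.ResidueField w.integer
  set σr : L →+* L := (σ : L →+* L) with hσr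
  -- `σ` restricted to `𝒪_w`, congruent to the identity modulo `𝔪_w`
  have hσO : ∀ x ∈ w.integer, σr x ∈ w.integer := fun x hx ↦ by
    rw [Valuation.mem_integer_iff] at hx ⊢
    rw [hσr]; change w (σ x) ≤ 1; rw [hσ]; exact hx
  set σ₀ : O →+* O := σr.restrict w.integer w.integer hσO with hσ₀
  have hσ₀L : ∀ a : O, algebraMap O L (σ₀ a) = σ (algebraMap O L a) := fun a ↦ rfl
  have hres : ∀ a : O, IsLocalRing.residue O (σ₀ a) = IsLocalRing.residue O a := by
    intro a
    rw [← sub_eq_zero, ← map_sub, IsLocalRing.residue_eq_zero_iff, IsLocalRing.mem_maximalIdeal,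
      mem_nonunits_iff, hv0.isUnit_iff_valuation_eq_one]
    intro h1
    have hlt := hσI (algebraMap O L a) (hv0.map_le_one a)
    rw [← hσ₀L, ← map_sub, h1] at hlt
    exact lt_irrefl _ hlt
  have hresσ : (IsLocalRing.residue O).comp σ₀ = IsLocalRing.residue O := RingHom.ext hres
  -- `σ(W') = A • ...`: the change of variables `A = C (σC)⁻¹`
  set A : VariableChange L := C * (C.map σr)⁻¹ with hA
  have hXσ : (X.baseChange L).map σr = X.baseChange L := X.map_baseChange (σ : L →ₐ[F] L)
  have hVσ : (W₀.baseChange L).map σr = (W₀.map σ₀).baseChange L := by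
    rw [WeierstrassCurve.baseChange, WeierstrassCurve.baseChange, WeierstrassCurve.map_map,
      WeierstrassCurve.map_map]
    congr 1
  have hAW : A • (W₀.map σ₀).baseChange L = W₀.baseChange L := by
    rw [← hVσ, ← hW₀, ← map_variableChange, hXσ, hA, mul_smul, inv_smul_smul]
  -- `A` is integral: lift it to `A₀` over `𝒪_w`
  haveI : ((W₀.map σ₀).baseChange L).IsIntegral O := ⟨W₀.map σ₀, rfl⟩
  haveI : (A • (W₀.map σ₀).baseChange L).IsIntegral O := by rw [hAW]; exact ⟨W₀, rfl⟩
  have hΔL : w (W₀.baseChange L).Δ = 1 := by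
    rw [WeierstrassCurve.baseChange, map_Δ]
    exact (hv0.isUnit_iff_valuation_eq_one).mp hΔ  -- hmm direction
  have hΔσ : w ((W₀.map σ₀).baseChange L).Δ = 1 := by
    rw [← hVσ, map_Δ, hσr]
    change w (σ (W₀.baseChange L).Δ) = 1
    rw [hσ, hΔL]
  obtain ⟨hu, hr, hs, ht⟩ := val_le_one_of_smul_eq_of_val_Δ_eq_one ((W₀.map σ₀).baseChange L) A
    hΔσ (by rw [hAW]; exact hΔL)
  have huu : IsUnit (⟨(A.u : L), le_of_eq hu⟩ : O) := (hv0.isUnit_iff_valuation_eq_one).mpr hu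
  set A₀ : VariableChange O := ⟨huu.unit, ⟨A.r, hr⟩, ⟨A.s, hs⟩, ⟨A.t, ht⟩⟩ with hA₀
  have hA₀A : A₀.map (algebraMap O L) = A := by
    rw [hA₀]
    ext
    · simp only [VariableChange.map, Units.coe_map, MonoidHom.coe_coe, IsUnit.unit_spec]; rfl
    · rfl
    · rfl
    · rfl
  have hA₀W : A₀ • W₀.map σ₀ = W₀ := by
    apply WeierstrassCurve.map_injective hinj
    change (A₀ • W₀.map σ₀).baseChange L = W₀.baseChange L
    rw [WeierstrassCurve.baseChange, ← map_variableChange, hA₀A]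
    exact hAW
  -- the reduced change of variables
  set Ã : VariableChange k := A₀.map (IsLocalRing.residue O) with hÃdef
  have hÃ : Ã • W₀.map (IsLocalRing.residue O) = W₀.map (IsLocalRing.residue O) := by
    have h' : (A₀ • W₀.map σ₀).map (IsLocalRing.residue O) = W₀.map (IsLocalRing.residue O) := by
      rw [hA₀W]
    rw [← map_variableChange, WeierstrassCurve.map_map, hresσ] at h'
    exact h'
  refine ⟨Ã, hÃ, fun P ↦ ?_⟩
  -- the coordinate identities `C.toX (σ x) = A.toX (σ (C.toX x))` etc.
  have hAC : A * C.map σr = C := by rw [hA, inv_mul_cancel_right]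
  have keyX : ∀ x : L, C.toX (σ x) = A.toX (σ (C.toX x)) := fun x ↦ by
    change C.toX (σr x) = A.toX (σr (C.toX x))
    rw [map_toX_ringHom, ← toX_mul, hAC]
  have keyY : ∀ x y : L, C.toY (σ x) (σ y) = A.toY (σ (C.toX x)) (σ (C.toY x y)) := fun x y ↦ by
    change C.toY (σr x) (σr y) = A.toY (σr (C.toX x)) (σr (C.toY x y))
    rw [map_toX_ringHom, map_toY_ringHom, ← toY_mul, hAC]
  rcases P with _ | ⟨x, y, h⟩
  · simp only [← Affine.Point.zero_def, map_zero]
  -- normalise `P^σ = (σ x, σ y)`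
  have hσns : (X.baseChange L).toAffine.Nonsingular (σ x) (σ y) := by
    have h1 : ((X.baseChange L).map σr).toAffine.Nonsingular (σ x) (σ y) :=
      (Affine.map_nonsingular _ σr.injective x y).mpr h
    rwa [hXσ] at h1
  have hmapP : Affine.Point.map (σ : L →ₐ[F] L) (.some x y h) = .some (σ x) (σ y) hσns := by
    rw [Affine.Point.map_some]
    exact point_some_congr rfl rfl
  rw [hmapP]
  -- `Φ P = (x', y')`
  set x' := C.toX x with hx'
  set y' := C.toY x y with hy'
  rw [VariableChange.pointEquiv_some, VariableChange.pointEquiv_some,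
    Affine.Point.congrEquiv_some, Affine.Point.congrEquiv_some]
  simp only [goodReductionHom_apply]
  have hnsΦ : (W₀.baseChange L).toAffine.Nonsingular x' y' :=
    hW₀ ▸ (VariableChange.nonsingular_iff (X.baseChange L) C x y).mpr h
  have hnsΦσ : (W₀.baseChange L).toAffine.Nonsingular (C.toX (σ x)) (C.toY (σ x) (σ y)) :=
    hW₀ ▸ (VariableChange.nonsingular_iff (X.baseChange L) C (σ x) (σ y)).mpr hσns
  by_cases hxint : w x' ≤ 1
  · -- integral point: both sides reduce to `(Ã x̄', Ã ȳ')`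
    have hyint : w y' ≤ 1 := v_Y_le_one_of_v_X_le_one hv0 (W := W₀) hnsΦ.1 hxint
    obtain ⟨a, ha⟩ := hv0.exists_of_le_one hxint
    obtain ⟨b, hb⟩ := hv0.exists_of_le_one hyint
    have hnsP : (W₀.baseChange L).toAffine.Nonsingular (algebraMap O L a) (algebraMap O L b) := by
      rw [ha, hb]; exact hnsΦ
    have hred₁ : WeierstrassCurve.reducePoint W₀ (.some x' y' hnsΦ) =
        .some (IsLocalRing.residue O a) (IsLocalRing.residue O b)
          ((WeierstrassCurve.hasNonsingularReduction_some_algebraMap_iff hinj hnsP).mp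
            (hasNonsingularReduction_of_isUnit_Δ hv0 hΔ _)) := by
      rw [← WeierstrassCurve.reducePoint_some_algebraMap hinj hnsP]
      congr 1
      exact point_some_congr ha.symm hb.symm
    -- the image point has coordinates `A₀.toX (σ₀ a)`, `A₀.toY (σ₀ a) (σ₀ b)`
    have hX2 : A.toX (σ x') = algebraMap O L (A₀.toX (σ₀ a)) := by
      rw [map_toX_ringHom, hA₀A, hσ₀L, ha]
    have hY2 : A.toY (σ x') (σ y') = algebraMap O L (A₀.toY (σ₀ a) (σ₀ b)) := by
      rw [map_toY_ringHom, hA₀A, hσ₀L, hσ₀L, ha, hb]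
    have hns2 : (W₀.baseChange L).toAffine.Nonsingular (algebraMap O L (A₀.toX (σ₀ a)))
        (algebraMap O L (A₀.toY (σ₀ a) (σ₀ b))) := by
      rw [← hX2, ← hY2, ← keyX, ← keyY]
      exact hnsΦσ
    have hred₂ : WeierstrassCurve.reducePoint W₀ (.some (C.toX (σ x)) (C.toY (σ x) (σ y)) hnsΦσ) =
        .some (IsLocalRing.residue O (A₀.toX (σ₀ a)))
          (IsLocalRing.residue O (A₀.toY (σ₀ a) (σ₀ b)))
          ((WeierstrassCurve.hasNonsingularReduction_some_algebraMap_iff hinj hns2).mp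
            (hasNonsingularReduction_of_isUnit_Δ hv0 hΔ _)) := by
      rw [← WeierstrassCurve.reducePoint_some_algebraMap hinj hns2]
      congr 1
      exact point_some_congr (by rw [keyX, hX2]) (by rw [keyY, hY2])
    have e₁ : WeierstrassCurve.reducePoint W₀ (.some x' y' hnsΦ) =
        WeierstrassCurve.reducePoint W₀ (.some x' y'
          (hW₀ ▸ (VariableChange.nonsingular_iff (X.baseChange L) C x y).mpr h)) := rfl
    have e₂ : WeierstrassCurve.reducePoint W₀ (.some (C.toX (σ x)) (C.toY (σ x) (σ y)) hnsΦσ) =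
        WeierstrassCurve.reducePoint W₀ (.some (C.toX (σ x)) (C.toY (σ x) (σ y))
          (hW₀ ▸ (VariableChange.nonsingular_iff (X.baseChange L) C (σ x) (σ y)).mpr hσns)) := rfl
    rw [← e₂, ← e₁, hred₂, hred₁, VariableChange.pointEquiv_some, Affine.Point.congrEquiv_some]
    refine point_some_congr ?_ ?_
    · rw [map_toX_ringHom, hres]
    · rw [map_toY_ringHom, hres, hres]
  · -- point of the kernel of reduction: both sides are `Õ`
    rw [not_le] at hxint
    have hx1 : x' ∉ Set.range (algebraMap O L) := (not_mem_range_iff hv0).mpr hxint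
    have hx2 : C.toX (σ x) ∉ Set.range (algebraMap O L) := by
      rw [not_mem_range_iff hv0, keyX, VariableChange.toX_def, map_mul, map_pow,
        Units.val_inv_eq_inv_val, map_inv₀, hu, inv_one, one_pow, one_mul]
      have hlt : w A.r < w (σ x') := by rw [hσ]; exact lt_of_le_of_lt hr hxint
      rw [Valuation.map_sub_eq_of_lt_left w hlt, hσ]
      exact hxint
    have e₁ : WeierstrassCurve.reducePoint W₀ (.some x' y'
        (hW₀ ▸ (VariableChange.nonsingular_iff (X.baseChange L) C x y).mpr h)) = 0 :=
      WeierstrassCurve.reducePoint_some_of_not_mem _ hx1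
    have e₂ : WeierstrassCurve.reducePoint W₀ (.some (C.toX (σ x)) (C.toY (σ x) (σ y))
        (hW₀ ▸ (VariableChange.nonsingular_iff (X.baseChange L) C (σ x) (σ y)).mpr hσns)) = 0 :=
      WeierstrassCurve.reducePoint_some_of_not_mem _ hx2
    rw [e₁, e₂, map_zero, map_zero]

end Core

/-! ## §4. Triviality on the `ℓ`-power torsion for one `ℓ` forces triviality on all prime-to-`p`
torsion -/

section Main

variable {L : Type u} [Field L] {w : Valuation L ℝ≥0}
  {F : Type*} [Field F] [Algebra F L]

/-- **Serre–Tate `ℓ`-independence of the triviality of inertia elements, in Weierstrass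
coordinates.**  In the situation of `exists_reducedAut_red_map_eq` (a good model `C • X_L = W₀ ⊗ L`
over the valuation ring of `(L, w)` of the base change of `X/F`, `C` defined over `L`; `σ ∈ Aut(L/F)`
an isometry acting trivially on the residue field), assume moreover that `L` is algebraically
closed of characteristic `0` and `X` is an elliptic curve.  If `σ` fixes every point of `X(L)`
killed by a power of one prime `ℓ` with `w(ℓ) = 1`, then `σ` fixes every point of `X(L)` killed
by any integer `m` with `w(m) = 1`.  Proof: the reductions of `Φ(P)`, `P` of `ℓ`-power order, are
pairwise distinct (*AEC* VII.3.1(b): `eq_zero_of_zsmul_eq_zero_of_goodReductionHom_eq_zero`) and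
infinitely many (`#X[ℓⁿ] = ℓ²ⁿ`, `card_torsionBy_eq_sq`), and all fixed by the reduced change of
variables `Ã` of `exists_reducedAut_red_map_eq`; so `Ã = 1`
(`VariableChange.eq_one_of_infinite_fixedPoints`), `red(Φ(P^σ)) = red(Φ(P))` for every `P`, and
for `mP = O` the point `Φ(P^σ - P)` is an `m`-torsion point of the kernel of reduction, i.e. `O`.
This is the statement "the kernel of the action of `I` on `T_ℓ` does not depend on `ℓ`" of
Serre–Tate 1968 §2 (Thm. 2 / Cor. 2) for elliptic curves, the input of Silverman *ATAEC*
Thm. IV.10.2(c) at the potentially good places (PDF p. 362: "Serre–Tate [1, §3]").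
[cite: SerreTate1968, §2 Thm. 2 and Cor. 2, §3]
[cite: SilvermanATAEC1994, Thm. IV.10.2(c) (PDF pp. 358, 362)] -/
theorem map_eq_of_forall_map_pow_torsion_eq [IsAlgClosed L] [CharZero L]
    (X : WeierstrassCurve F) [(X.baseChange L).IsElliptic] (C : VariableChange L)
    {W₀ : WeierstrassCurve w.integer} (hW₀ : C • X.baseChange L = W₀.baseChange L)
    (hΔ : IsUnit W₀.Δ) (σ : L ≃ₐ[F] L) (hσ : ∀ z, w (σ z) = w z)
    (hσI : ∀ z, w z ≤ 1 → w (σ z - z) < 1)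
    {ℓ : ℕ} (hℓ1 : 1 < ℓ) (hℓ : w (ℓ : L) = 1)
    (hfix : ∀ (n : ℕ) (P : (X.baseChange L).toAffine.Point), (ℓ ^ n : ℤ) • P = 0 →
      Affine.Point.map (σ : L →ₐ[F] L) P = P)
    {m : ℤ} (hm : w (m : L) = 1) (P : (X.baseChange L).toAffine.Point) (hP : m • P = 0) :
    Affine.Point.map (σ : L →ₐ[F] L) P = P := by
  have hv0 : w.Integers w.integer := Valuation.integer.integers w
  obtain ⟨Ã, hÃ, hcore⟩ := exists_reducedAut_red_map_eq X C hW₀ hΔ σ hσ hσI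
  -- notation: `Φ`, `red`, `𝔄`
  set Φ : (X.baseChange L).toAffine.Point ≃+ (W₀.baseChange L).toAffine.Point :=
    (VariableChange.pointEquiv (X.baseChange L) C).trans (Affine.Point.congrEquiv hW₀) with hΦ
  set red := goodReductionHom W₀ hv0 hΔ with hred
  set 𝔄 : (W₀.map (IsLocalRing.residue w.integer)).toAffine.Point ≃+
      (W₀.map (IsLocalRing.residue w.integer)).toAffine.Point :=
    (VariableChange.pointEquiv _ Ã).trans (Affine.Point.congrEquiv hÃ) with h𝔄
  have hcore' : ∀ Q : (X.baseChange L).toAffine.Point,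
      red (Φ (Affine.Point.map (σ : L →ₐ[F] L) Q)) = 𝔄 (red (Φ Q)) := fun Q ↦ hcore Q
  -- valuations of powers of `ℓ`
  have hℓpow : ∀ n : ℕ, w ((ℓ ^ n : ℤ) : L) = 1 := fun n ↦ by
    rw [Int.cast_pow, Int.cast_natCast, map_pow, hℓ, one_pow]
  -- the `ℓ`-power torsion `T` and the injectivity of `red ∘ Φ` on it
  set T : Set (X.baseChange L).toAffine.Point := {Q | ∃ n : ℕ, (ℓ ^ n : ℤ) • Q = 0} with hT
  have hinj : Set.InjOn (fun Q ↦ red (Φ Q)) T := by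
    rintro Q₁ ⟨n₁, h₁⟩ Q₂ ⟨n₂, h₂⟩ hQ
    have h12 : (ℓ ^ (n₁ + n₂) : ℤ) • (Q₁ - Q₂) = 0 := by
      rw [smul_sub, pow_add, mul_comm, mul_smul, h₁, smul_zero, mul_comm, mul_smul, h₂, smul_zero,
        sub_zero]
    have h0 : red (Φ (Q₁ - Q₂)) = 0 := by
      rw [map_sub, map_sub]
      exact sub_eq_zero.mpr hQ
    have hΦ0 : Φ (Q₁ - Q₂) = 0 :=
      eq_zero_of_zsmul_eq_zero_of_goodReductionHom_eq_zero hv0 hΔ (hℓpow (n₁ + n₂))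
        (by rw [← map_zsmul, h12, map_zero]) h0
    exact sub_eq_zero.mp (Φ.injective (by rw [hΦ0, map_zero]))
  -- `T` is infinite: it contains `X[ℓⁿ]`, of cardinality `ℓ²ⁿ`
  have hTinf : T.Infinite := by
    intro hfin
    haveI : Finite T := hfin.to_subtype
    set c := Nat.card T with hc
    have hcard : ∀ n : ℕ, (ℓ ^ n) ^ 2 ≤ c := by
      intro n
      have hn0 : ((ℓ ^ n : ℕ) : L) ≠ 0 := by
        exact_mod_cast pow_ne_zero n (by omega : ℓ ≠ 0)
      have hcn := card_torsionBy_eq_sq (E := X.baseChange L) hn0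
      have hsub : ∀ Q : (X.baseChange L).toAffine.Point,
          Q ∈ AddSubgroup.torsionBy (X.baseChange L).toAffine.Point ((ℓ ^ n : ℕ) : ℤ) → Q ∈ T := by
        intro Q hQ
        refine ⟨n, ?_⟩
        have := (Submodule.mem_torsionBy_iff _ _).mp hQ
        exact_mod_cast this
      rw [← hcn]
      exact Nat.card_le_card_of_injective
        (fun Q : AddSubgroup.torsionBy (X.baseChange L).toAffine.Point ((ℓ ^ n : ℕ) : ℤ) ↦
          (⟨Q.1, hsub Q.1 Q.2⟩ : T))
        (fun Q₁ Q₂ h ↦ Subtype.ext (congrArg (fun R : T ↦ (R : (X.baseChange L).toAffine.Point)) h))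
    have key := hcard c
    have h1 : c < ℓ ^ c := Nat.lt_pow_self hℓ1
    have h2 : ℓ ^ c ≤ (ℓ ^ c) ^ 2 := Nat.le_self_pow two_ne_zero _
    omega
  -- every reduction `red (Φ Q)`, `Q ∈ T`, is fixed by `𝔄`; hence `Ã = 1`
  have hfixed : (fun Q ↦ red (Φ Q)) '' T ⊆
      {R | Affine.Point.congrEquiv hÃ (VariableChange.pointEquiv _ Ã R) = R} := by
    rintro _ ⟨Q, ⟨n, hn⟩, rfl⟩
    change 𝔄 (red (Φ Q)) = red (Φ Q)
    rw [← hcore', hfix n Q hn]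
  have hÃ1 : Ã = 1 :=
    VariableChange.eq_one_of_infinite_fixedPoints hÃ ((hTinf.image hinj).mono hfixed)
  -- so `𝔄 = id` and `red ∘ Φ` is `σ`-invariant
  have h𝔄 : ∀ R, 𝔄 R = R := by
    subst hÃ1
    intro R
    rcases R with _ | ⟨x, y, h⟩
    · simp only [← Affine.Point.zero_def, map_zero]
    · change Affine.Point.congrEquiv hÃ (VariableChange.pointEquiv _ 1 (.some x y h)) = _
      rw [VariableChange.pointEquiv_some, Affine.Point.congrEquiv_some]
      exact point_some_congr (toX_one x) (toY_one x y)
  have hinv : red (Φ (Affine.Point.map (σ : L →ₐ[F] L) P)) = red (Φ P) := by rw [hcore', h𝔄]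
  -- conclude: `Φ (P^σ - P)` is an `m`-torsion point of the kernel of reduction
  have hmP : m • (Affine.Point.map (σ : L →ₐ[F] L) P - P) = 0 := by
    rw [smul_sub, ← map_zsmul, hP, map_zero, zero_sub, neg_eq_zero]
  have h0 : red (Φ (Affine.Point.map (σ : L →ₐ[F] L) P - P)) = 0 := by
    rw [map_sub, map_sub, hinv, sub_self]
  have hΦ0 : Φ (Affine.Point.map (σ : L →ₐ[F] L) P - P) = 0 :=
    eq_zero_of_zsmul_eq_zero_of_goodReductionHom_eq_zero hv0 hΔ hm
      (by rw [← map_zsmul, hmP, map_zero]) h0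
  exact sub_eq_zero.mp (Φ.injective (by rw [hΦ0, map_zero]))

end Main

end Literature.NumberTheory.EllipticCurves

end
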